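import Literature.NumberTheory.EllipticCurves.CongruenceEisensteinWeightOneBounds
import Literature.NumberTheory.EllipticCurves.Gamma0EisensteinWeightOneAllPairs
import Mathlib.Analysis.Complex.CauchyIntegral
import Mathlib.Analysis.Complex.Convex
import HarnessLib

/-!
# The weight-one Eisenstein series with character at the other cusps

Topic `Literature/NumberTheory/EllipticCurves`; namespace
`Literature.NumberTheory.EllipticCurves.ModularForms`. One definition with a body (`cuspWeight`)
and theorems; no named fact.

Let `χ` be a Dirichlet character mod `M`, `G(z, s) = ∑_{(c,d), M ∣ c} χ(d)(cz+d)⁻¹(y/|cz+d|²)ˢ`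
the all-pairs sum (`eisensteinOneAll`, `Re s > 1/2`) and `A ∈ SL₂(ℤ)`. Moving the cusp `A∞` to
`∞`:

* `linear_smul_eq_div'`, `e1Base_vecMul` — for EVERY `v ∈ ℤ²`:
  `v(Az) = (vA)(z)/j(A, z)` and `Im(Az)/|v(Az)|² = Im z/|(vA)(z)|²` (Mathlib
  `EisensteinSeries.eisSummand_SL2_apply` with `k = 1`); hence
  `e1Term_smul'` — `e_v^χ(Az, s) = j(A, z) χ(v₂) e_{vA}(z, s)` with the plain summand `e1Plain`;
* `eisensteinOneAll_smul` — **`G(Az, s) = j(A, z) ∑_{v ∈ ℤ²} W_A(v) e_v(z, s)`** with the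
  `M`-periodic weight `W_A(v) = 𝟙[M ∣ (vA⁻¹)₁] χ((vA⁻¹)₂)` (`cuspWeight`; reindexing `v ↦ vA`);
* `tsum_mul_e1Plain_eq_sum_congrSum` — for `Re s > 1/2` and any weight `W` that is `M`-periodic in
  both coordinates, `∑_v W(v) e_v(z, s) = ∑_{v₀ ∈ (ℤ/M)²} W(v₀) G(z, s; v₀)` (the congruence
  Eisenstein series of `CongruenceEisensteinWeightOne.lean`);
* `eq_sum_congrCont_of_eqOn` — **identity theorem**: any function holomorphic on `Re s > -1/2` that
  agrees with `s ↦ G(Az, s)` on `Re s > 1/2` equals `j(A, z) ∑_{v₀} W_A(v₀) congrCont(z, s; v₀)`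
  on all of `Re s > -1/2` (this applies to Hecke's continuation `G̃(A·, s)` of
  `Gamma0EisensteinWeightOneContinuation.lean`);
* `exists_bound_sum_congrCont_box` — and the right-hand side has **polynomial growth in `Im z`,
  uniformly on boxes in `s`**: `‖∑_{v₀} W_A(v₀) congrCont(z, s; v₀)‖ ≤ C (y^A + y^{-A})`.

So Hecke's continued weight-one Eisenstein series has moderate growth at every cusp, uniformly for
`s` in compacts of `Re s > -1/2` — the input of the Rankin–Selberg unfolding (Hecke 1927, §2;
Shimura 1976, §2).

## References

* E. Hecke, *Theorie der Eisensteinschen Reihen höherer Stufe…*, Abh. Math. Sem. Hamburg 5 (1927),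
  §2.
* G. Shimura, *The special values of the zeta functions associated with cusp forms*, Comm. Pure
  Appl. Math. 29 (1976), §2.
-/

noncomputable section

open Complex Real Set MeasureTheory Filter Finset EisensteinSeries ModularGroup Matrix
  UpperHalfPlane
open scoped Topology MatrixGroups

namespace Literature.NumberTheory.EllipticCurves.ModularForms

/-- The integer matrix of an element of `SL(2, ℤ)` (Mathlib's local notation). -/
local notation:1024 "↑ₘ" A:1024 => ((A : SL(2, ℤ)) : Matrix (Fin 2) (Fin 2) ℤ)

variable {M : ℕ} (χ : DirichletCharacter ℂ M)

/-! ### The summand under `SL₂(ℤ)`, for every `v` -/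

/-- **`v(Az) = (vA)(z)/j(A, z)`** for every `v ∈ ℤ²` (from Mathlib's `eisSummand_SL2_apply` with
`k = 1`). [folklore] -/
theorem linear_smul_eq_div' (v : Fin 2 → ℤ) (A : SL(2, ℤ)) (z : ℍ) :
    (v 0 : ℂ) * (A • z : ℍ) + v 1 = (((v ᵥ* ↑ₘA) 0 : ℂ) * z + (v ᵥ* ↑ₘA) 1) / denom A z := by
  have h := eisSummand_SL2_apply 1 v A z
  simp only [eisSummand, _root_.zpow_neg, zpow_one] at h
  have hD : denom A z ≠ 0 := denom_ne_zero A z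
  -- invert both sides
  have h' := congrArg Inv.inv h
  rw [inv_inv, mul_inv, inv_inv] at h'
  rw [h']
  field_simp

/-- **`Im(Az)/|v(Az)|² = Im z/|(vA)(z)|²`** for every `v ∈ ℤ²`. [folklore] -/
theorem e1Base_vecMul (v : Fin 2 → ℤ) (A : SL(2, ℤ)) (z : ℍ) :
    e1Base v (A • z) = e1Base (v ᵥ* ↑ₘA) z := by
  unfold e1Base
  have hD : denom A z ≠ 0 := denom_ne_zero A z
  have hDn : 0 < ‖denom A z‖ := norm_pos_iff.mpr hD
  rw [linear_smul_eq_div' v A z, ModularGroup.im_smul_eq_div_normSq A z, norm_div, div_pow,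
    Complex.normSq_eq_norm_sq]
  rcases eq_or_ne (((v ᵥ* ↑ₘA) 0 : ℂ) * z + (v ᵥ* ↑ₘA) 1) 0 with hL | hL
  · rw [hL]; simp
  · have hLn : 0 < ‖((v ᵥ* ↑ₘA) 0 : ℂ) * z + (v ᵥ* ↑ₘA) 1‖ := norm_pos_iff.mpr hL
    field_simp

/-- **`e_v^χ(Az, s) = j(A, z) χ(v₂) e_{vA}(z, s)`** for every `v` (the character stays on `v`).
[folklore] -/
theorem e1Term_smul' (s : ℂ) (v : Fin 2 → ℤ) (A : SL(2, ℤ)) (z : ℍ) :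
    e1Term χ s v (A • z) = denom A z * (χ (v 1) * e1Plain s (v ᵥ* ↑ₘA) z) := by
  unfold e1Term e1Plain
  have hD : denom A z ≠ 0 := denom_ne_zero A z
  rw [e1Base_vecMul v A z, linear_smul_eq_div' v A z, inv_div]
  rcases eq_or_ne (((v ᵥ* ↑ₘA) 0 : ℂ) * z + (v ᵥ* ↑ₘA) 1) 0 with hL | hL
  · rw [hL]; simp
  · field_simp

/-! ### The weight at the cusp `A∞` and the reindexing `v ↦ vA` -/

/-- The all-pairs weight `𝟙[M ∣ c] χ(d)`. [folklore] -/
def allPairsWeight (v : Fin 2 → ℤ) : ℂ := if (M : ℤ) ∣ v 0 then χ (v 1) else 0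

/-- **The weight at the cusp `A∞`**: `W_A(v) = 𝟙[M ∣ (vA⁻¹)₁] χ((vA⁻¹)₂)`. [folklore] -/
def cuspWeight (A : SL(2, ℤ)) (v : Fin 2 → ℤ) : ℂ := allPairsWeight χ (v ᵥ* ↑ₘ(A⁻¹))

/-- `gTerm = 𝟙[M ∣ c] χ(d) · e_v`. [folklore] -/
theorem gTerm_eq_weight_mul (s : ℂ) (v : Fin 2 → ℤ) (z : ℍ) :
    gTerm χ s v z = allPairsWeight χ v * e1Plain s v z := by
  unfold gTerm allPairsWeight e1Term e1Plain
  split_ifs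
  · ring
  · simp

/-- `(vA)A⁻¹ = v`. [folklore] -/
theorem vecMul_vecMul_inv (v : Fin 2 → ℤ) (A : SL(2, ℤ)) : (v ᵥ* ↑ₘA) ᵥ* ↑ₘ(A⁻¹) = v := by
  rw [Matrix.vecMul_vecMul, ← Matrix.SpecialLinearGroup.coe_mul, mul_inv_cancel,
    Matrix.SpecialLinearGroup.coe_one, Matrix.vecMul_one]

/-- `(vA⁻¹)A = v`. [folklore] -/
theorem vecMul_inv_vecMul (v : Fin 2 → ℤ) (A : SL(2, ℤ)) : (v ᵥ* ↑ₘ(A⁻¹)) ᵥ* ↑ₘA = v := by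
  rw [Matrix.vecMul_vecMul, ← Matrix.SpecialLinearGroup.coe_mul, inv_mul_cancel,
    Matrix.SpecialLinearGroup.coe_one, Matrix.vecMul_one]

/-- Right multiplication by `A` as a permutation of `ℤ²`. [folklore] -/
def vecMulEquiv (A : SL(2, ℤ)) : (Fin 2 → ℤ) ≃ (Fin 2 → ℤ) where
  toFun v := v ᵥ* ↑ₘA
  invFun v := v ᵥ* ↑ₘ(A⁻¹)
  left_inv v := vecMul_vecMul_inv v A
  right_inv v := vecMul_inv_vecMul v A

/-- The bound `|W_A(v)| ≤ 1`. [folklore] -/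
theorem norm_cuspWeight_le (A : SL(2, ℤ)) (v : Fin 2 → ℤ) : ‖cuspWeight χ A v‖ ≤ 1 := by
  unfold cuspWeight allPairsWeight
  split_ifs
  · exact DirichletCharacter.norm_le_one χ _
  · simp

/-- `W_A` is `M`-periodic in both coordinates. [folklore] -/
theorem cuspWeight_congr (A : SL(2, ℤ)) {v w : Fin 2 → ℤ} (h0 : (M : ℤ) ∣ v 0 - w 0)
    (h1 : (M : ℤ) ∣ v 1 - w 1) : cuspWeight χ A v = cuspWeight χ A w := by
  unfold cuspWeight allPairsWeight
  have e0 : (M : ℤ) ∣ (v ᵥ* ↑ₘ(A⁻¹)) 0 - (w ᵥ* ↑ₘ(A⁻¹)) 0 := by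
    rw [vecMul_SL_apply, vecMul_SL_apply,
      show v 0 * (A⁻¹) 0 0 + v 1 * (A⁻¹) 1 0 - (w 0 * (A⁻¹) 0 0 + w 1 * (A⁻¹) 1 0) =
        (v 0 - w 0) * (A⁻¹) 0 0 + (v 1 - w 1) * (A⁻¹) 1 0 by ring]
    exact dvd_add (dvd_mul_of_dvd_left h0 _) (dvd_mul_of_dvd_left h1 _)
  have e1 : ((v ᵥ* ↑ₘ(A⁻¹)) 1 : ZMod M) = ((w ᵥ* ↑ₘ(A⁻¹)) 1 : ZMod M) := by
    rw [ZMod.intCast_eq_intCast_iff_dvd_sub]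
    rw [vecMul_SL_apply, vecMul_SL_apply,
      show w 0 * (A⁻¹) 0 1 + w 1 * (A⁻¹) 1 1 - (v 0 * (A⁻¹) 0 1 + v 1 * (A⁻¹) 1 1) =
        -((v 0 - w 0) * (A⁻¹) 0 1 + (v 1 - w 1) * (A⁻¹) 1 1) by ring]
    exact (dvd_add (dvd_mul_of_dvd_left h0 _) (dvd_mul_of_dvd_left h1 _)).neg_right
  have hiff : (M : ℤ) ∣ (v ᵥ* ↑ₘ(A⁻¹)) 0 ↔ (M : ℤ) ∣ (w ᵥ* ↑ₘ(A⁻¹)) 0 := by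
    constructor
    · intro h; have := dvd_sub h e0; simpa using this
    · intro h; have := dvd_add h e0; simpa using this
  by_cases h : (M : ℤ) ∣ (v ᵥ* ↑ₘ(A⁻¹)) 0
  · rw [if_pos h, if_pos (hiff.mp h), e1]
  · rw [if_neg h, if_neg (fun h' ↦ h (hiff.mpr h'))]

/-- **`G(Az, s) = j(A, z) ∑_{v ∈ ℤ²} W_A(v) e_v(z, s)`** (reindexing by `v ↦ vA`; no convergence
needed). [folklore] -/
theorem eisensteinOneAll_smul (A : SL(2, ℤ)) (z : ℍ) (s : ℂ) :
    eisensteinOneAll χ (A • z) s = denom A z * ∑' v : Fin 2 → ℤ, cuspWeight χ A v * e1Plain s v z := by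
  unfold eisensteinOneAll
  rw [← tsum_mul_left]
  rw [← (vecMulEquiv A).tsum_eq (fun v ↦ denom A z * (cuspWeight χ A v * e1Plain s v z))]
  refine tsum_congr fun v ↦ ?_
  simp only [vecMulEquiv, Equiv.coe_fn_mk, cuspWeight, vecMul_vecMul_inv]
  rw [gTerm_eq_weight_mul χ s v (A • z)]
  unfold allPairsWeight
  split_ifs with h
  · unfold e1Plain
    rw [e1Base_vecMul v A z, linear_smul_eq_div' v A z, inv_div]
    have hD : denom A z ≠ 0 := denom_ne_zero A z
    rcases eq_or_ne (((v ᵥ* ↑ₘA) 0 : ℂ) * z + (v ᵥ* ↑ₘA) 1) 0 with hL | hL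
    · rw [hL]; simp
    · field_simp
  · simp

/-! ### Periodic weights: `∑_v W(v) e_v = ∑_{v₀ mod M} W(v₀) G(z, s; v₀)` -/

section Classes

variable (hM : 0 < M)
include hM

/-- The residue of `a` in `Fin M`. [folklore] -/
def residueFin (a : ℤ) : Fin M :=
  ⟨(a % (M : ℤ)).toNat, by
    have h0 : 0 ≤ a % (M : ℤ) := Int.emod_nonneg a (by exact_mod_cast hM.ne')
    have h1 : a % (M : ℤ) < M := Int.emod_lt_of_pos a (by exact_mod_cast hM)
    omega⟩

/-- `residueFin a ≡ a (mod M)` as integers: `((residueFin a : ℕ) : ℤ) = a % M`. [folklore] -/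
theorem coe_residueFin (a : ℤ) : (((residueFin hM a : Fin M) : ℕ) : ℤ) = a % (M : ℤ) := by
  unfold residueFin
  simp only
  exact Int.toNat_of_nonneg (Int.emod_nonneg a (by exact_mod_cast hM.ne'))

/-- `M ∣ a - residueFin a`. [folklore] -/
theorem dvd_sub_residueFin (a : ℤ) : (M : ℤ) ∣ a - (((residueFin hM a : Fin M) : ℕ) : ℤ) := by
  rw [coe_residueFin]
  exact ⟨a / (M : ℤ), by have := Int.emod_add_mul_ediv a (M : ℤ); linarith⟩

/-- Uniqueness of the residue: `M ∣ a - r`, `r ∈ Fin M` forces `r = residueFin a`. [folklore] -/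
theorem residueFin_eq_of_dvd {a : ℤ} {r : Fin M} (h : (M : ℤ) ∣ a - ((r : ℕ) : ℤ)) :
    residueFin hM a = r := by
  apply Fin.ext
  have h1 : a % (M : ℤ) = ((r : ℕ) : ℤ) % (M : ℤ) :=
    Int.emod_eq_emod_iff_emod_sub_eq_zero.mpr (Int.emod_eq_zero_of_dvd h)
  rw [Int.emod_eq_of_lt (a := ((r : ℕ) : ℤ)) (by positivity) (by exact_mod_cast r.2)] at h1
  have h2 := coe_residueFin hM a
  rw [h1] at h2
  exact_mod_cast h2

/-- The representative `(r₁, r₂) ∈ ℤ²` of a class `p ∈ (Fin M)²`. [folklore] -/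
theorem dvd_iff_eq_residueFin (v : Fin 2 → ℤ) (p : Fin M × Fin M) :
    ((M : ℤ) ∣ v 0 - ((p.1 : ℕ) : ℤ) ∧ (M : ℤ) ∣ v 1 - ((p.2 : ℕ) : ℤ)) ↔
      p = (residueFin hM (v 0), residueFin hM (v 1)) := by
  constructor
  · rintro ⟨h0, h1⟩
    exact Prod.ext (residueFin_eq_of_dvd hM h0).symm (residueFin_eq_of_dvd hM h1).symm
  · rintro rfl
    exact ⟨dvd_sub_residueFin hM (v 0), dvd_sub_residueFin hM (v 1)⟩

/-- **Periodic weights**: for `Re s > 1/2` and a bounded weight `W` that is `M`-periodic in both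
coordinates, `∑_v W(v) e_v(z, s) = ∑_{v₀ ∈ (ℤ/M)²} W(v₀) G(z, s; v₀)`. [folklore] -/
theorem tsum_mul_e1Plain_eq_sum_congrSum {W : (Fin 2 → ℤ) → ℂ}
    (hW : ∀ v w : Fin 2 → ℤ, (M : ℤ) ∣ v 0 - w 0 → (M : ℤ) ∣ v 1 - w 1 → W v = W w)
    {B : ℝ} (hB : ∀ v, ‖W v‖ ≤ B) {s : ℂ} (hs : 1 / 2 < s.re) (z : ℍ) :
    ∑' v : Fin 2 → ℤ, W v * e1Plain s v z =
      ∑ p : Fin M × Fin M, W ![((p.1 : ℕ) : ℤ), ((p.2 : ℕ) : ℤ)] *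
        congrSum M ![((p.1 : ℕ) : ℤ), ((p.2 : ℕ) : ℤ)] z s := by
  have hB0 : 0 ≤ B := (norm_nonneg _).trans (hB 0)
  have hsum := summable_e1Plain hs z
  -- each class series is summable
  have hp : ∀ p : Fin M × Fin M, Summable fun v : Fin 2 → ℤ ↦
      W ![((p.1 : ℕ) : ℤ), ((p.2 : ℕ) : ℤ)] *
        (if (M : ℤ) ∣ v 0 - (![((p.1 : ℕ) : ℤ), ((p.2 : ℕ) : ℤ)] : Fin 2 → ℤ) 0 ∧
            (M : ℤ) ∣ v 1 - (![((p.1 : ℕ) : ℤ), ((p.2 : ℕ) : ℤ)] : Fin 2 → ℤ) 1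
          then e1Plain s v z else 0) := by
    intro p
    refine Summable.of_norm_bounded ((hsum.norm.mul_left B)) fun v ↦ ?_
    rw [norm_mul]
    refine mul_le_mul (hB _) ?_ (norm_nonneg _) hB0
    split_ifs
    · exact le_rfl
    · rw [norm_zero]; exact norm_nonneg _
  unfold congrSum
  simp_rw [← tsum_mul_left]
  rw [← Summable.tsum_finsetSum (fun p _ ↦ hp p)]
  refine tsum_congr fun v ↦ ?_
  -- only the class of `v` contributes
  rw [Finset.sum_eq_single (residueFin hM (v 0), residueFin hM (v 1))]
  · simp only [Matrix.cons_val_zero, Matrix.cons_val_one]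
    rw [if_pos ⟨dvd_sub_residueFin hM (v 0), dvd_sub_residueFin hM (v 1)⟩]
    congr 1
    refine hW v _ ?_ ?_
    · simp only [Matrix.cons_val_zero]; exact dvd_sub_residueFin hM (v 0)
    · simp only [Matrix.cons_val_one]; exact dvd_sub_residueFin hM (v 1)
  · intro p _ hp'
    simp only [Matrix.cons_val_zero, Matrix.cons_val_one]
    rw [if_neg (fun h ↦ hp' ((dvd_iff_eq_residueFin hM v p).mp h)), mul_zero]
  · intro h; exact absurd (Finset.mem_univ _) h

end Classes

/-! ### The identity theorem at the cusp `A∞` -/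

section Transfer

variable (hM : 0 < M) (A : SL(2, ℤ)) (z : ℍ)
include hM

/-- The right-hand side at the cusp: `j(A, z) ∑_{v₀} W_A(v₀) congrCont(z, s; v₀)`, holomorphic on
`Re s > -1/2`. [folklore] -/
theorem differentiableOn_sum_congrCont :
    DifferentiableOn ℂ (fun s : ℂ ↦ denom A z * ∑ p : Fin M × Fin M,
      cuspWeight χ A ![((p.1 : ℕ) : ℤ), ((p.2 : ℕ) : ℤ)] *
        congrCont M ![((p.1 : ℕ) : ℤ), ((p.2 : ℕ) : ℤ)] z s) {s : ℂ | -1 / 2 < s.re} := by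
  refine (differentiableOn_const _).mul (DifferentiableOn.fun_sum fun p _ ↦ ?_)
  exact (differentiableOn_const _).mul (differentiableOn_congrCont hM _ z)

/-- **Identity theorem at the cusp `A∞`**: a function holomorphic on `Re s > -1/2` which agrees
with `s ↦ G(Az, s)` on `Re s > 1/2` equals `j(A, z) ∑_{v₀ mod M} W_A(v₀) congrCont(z, s; v₀)`
on all of `Re s > -1/2`. [folklore] -/
theorem eq_sum_congrCont_of_eqOn {G : ℂ → ℂ} (hG : DifferentiableOn ℂ G {s : ℂ | -1 / 2 < s.re})
    (hGeq : ∀ s : ℂ, 1 / 2 < s.re → G s = eisensteinOneAll χ (A • z) s) {s : ℂ}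
    (hs : -1 / 2 < s.re) :
    G s = denom A z * ∑ p : Fin M × Fin M,
      cuspWeight χ A ![((p.1 : ℕ) : ℤ), ((p.2 : ℕ) : ℤ)] *
        congrCont M ![((p.1 : ℕ) : ℤ), ((p.2 : ℕ) : ℤ)] z s := by
  set U : Set ℂ := {s : ℂ | -1 / 2 < s.re} with hU
  have hUo : IsOpen U := isOpen_lt continuous_const Complex.continuous_re
  have hUc : IsPreconnected U := (convex_halfSpace_re_gt (-1 / 2)).isPreconnected
  set F : ℂ → ℂ := fun s ↦ G s - denom A z * ∑ p : Fin M × Fin M,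
      cuspWeight χ A ![((p.1 : ℕ) : ℤ), ((p.2 : ℕ) : ℤ)] *
        congrCont M ![((p.1 : ℕ) : ℤ), ((p.2 : ℕ) : ℤ)] z s with hF
  have hFd : DifferentiableOn ℂ F U := hG.sub (differentiableOn_sum_congrCont χ hM A z)
  have hFa : AnalyticOnNhd ℂ F U := hFd.analyticOnNhd hUo
  have h1U : (1 : ℂ) ∈ U := by
    simp only [hU, Set.mem_setOf_eq, Complex.one_re]; norm_num
  have hV : {s : ℂ | 1 / 2 < s.re} ∈ 𝓝 (1 : ℂ) :=
    (isOpen_lt continuous_const Complex.continuous_re).mem_nhds (by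
      simp only [Set.mem_setOf_eq, Complex.one_re]; norm_num)
  have hF0 : F =ᶠ[𝓝 1] 0 := by
    filter_upwards [hV] with t ht
    simp only [hF, Pi.zero_apply]
    rw [hGeq t ht, eisensteinOneAll_smul χ A z t,
      tsum_mul_e1Plain_eq_sum_congrSum hM (W := cuspWeight χ A)
        (fun v w h0 h1 ↦ cuspWeight_congr χ A h0 h1) (norm_cuspWeight_le χ A) ht z, sub_eq_zero]
    congr 1
    refine Finset.sum_congr rfl fun p _ ↦ ?_
    rw [congrSum_eq_congrCont hM _ z ht]
  have h := hFa.eqOn_zero_of_preconnected_of_eventuallyEq_zero hUc h1U hF0 hs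
  simp only [hF, Pi.zero_apply] at h
  exact sub_eq_zero.mp h

/-- **Polynomial growth at the cusps, uniformly in the cusp and on boxes in `s`**: for
`-1/2 < a < b`, `0 < T` there are `C, A' ≥ 0` with
`‖∑_{v₀} W_B(v₀) congrCont(z, s; v₀)‖ ≤ C (y^{A'} + y^{-A'})` for every `B ∈ SL(2, ℤ)` whenever
`a < Re s < b`, `|Im s| < T` (the weights have norm `≤ 1` and the constants of
`exists_bound_congrCont_box` do not see `B`). [folklore] -/
theorem exists_bound_sum_congrCont_box {a b T : ℝ} (ha : -1 / 2 < a) (hab : a < b) (hT : 0 < T) :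
    ∃ C A' : ℝ, 0 ≤ C ∧ 0 ≤ A' ∧ ∀ (B : SL(2, ℤ)) (s : ℂ), a < s.re → s.re < b → |s.im| < T →
      ∀ z : ℍ, ‖∑ p : Fin M × Fin M, cuspWeight χ B ![((p.1 : ℕ) : ℤ), ((p.2 : ℕ) : ℤ)] *
          congrCont M ![((p.1 : ℕ) : ℤ), ((p.2 : ℕ) : ℤ)] z s‖ ≤
        C * (z.im ^ A' + z.im ^ (-A')) := by
  have h := fun p : Fin M × Fin M ↦
    exists_bound_congrCont_box hM (![((p.1 : ℕ) : ℤ), ((p.2 : ℕ) : ℤ)] : Fin 2 → ℤ) ha hab hT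
  choose C A' hC0 hA0 hb using h
  have hCsum : 0 ≤ ∑ p : Fin M × Fin M, C p := Finset.sum_nonneg fun p _ ↦ hC0 p
  have hAsum : 0 ≤ ∑ p : Fin M × Fin M, A' p := Finset.sum_nonneg fun p _ ↦ hA0 p
  refine ⟨2 * ∑ p : Fin M × Fin M, C p, ∑ p : Fin M × Fin M, A' p, by positivity, hAsum, ?_⟩
  intro B s hsa hsb hsT z
  have hy : 0 < z.im := z.im_pos
  set At : ℝ := ∑ p : Fin M × Fin M, A' p with hAt
  have hAp : ∀ p : Fin M × Fin M, A' p ≤ At := fun p ↦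
    Finset.single_le_sum (f := A') (fun q _ ↦ hA0 q) (Finset.mem_univ p)
  have htwo : ∀ p : Fin M × Fin M, z.im ^ A' p + z.im ^ (-A' p) ≤ 2 * (z.im ^ At + z.im ^ (-At)) := by
    intro p
    have h1 : z.im ^ A' p ≤ z.im ^ At + z.im ^ (-At) :=
      rpow_le_rpow_add_rpow_neg hy (by rw [abs_of_nonneg (hA0 p)]; exact hAp p)
    have h2 : z.im ^ (-A' p) ≤ z.im ^ At + z.im ^ (-At) :=
      rpow_le_rpow_add_rpow_neg hy (by rw [abs_neg, abs_of_nonneg (hA0 p)]; exact hAp p)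
    linarith
  calc ‖∑ p : Fin M × Fin M, cuspWeight χ B ![((p.1 : ℕ) : ℤ), ((p.2 : ℕ) : ℤ)] *
          congrCont M ![((p.1 : ℕ) : ℤ), ((p.2 : ℕ) : ℤ)] z s‖
      ≤ ∑ p : Fin M × Fin M, ‖cuspWeight χ B ![((p.1 : ℕ) : ℤ), ((p.2 : ℕ) : ℤ)] *
          congrCont M ![((p.1 : ℕ) : ℤ), ((p.2 : ℕ) : ℤ)] z s‖ := norm_sum_le _ _
    _ ≤ ∑ p : Fin M × Fin M, C p * (z.im ^ A' p + z.im ^ (-A' p)) := by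
        refine Finset.sum_le_sum fun p _ ↦ ?_
        rw [norm_mul]
        calc ‖cuspWeight χ B ![((p.1 : ℕ) : ℤ), ((p.2 : ℕ) : ℤ)]‖ *
              ‖congrCont M ![((p.1 : ℕ) : ℤ), ((p.2 : ℕ) : ℤ)] z s‖
            ≤ 1 * (C p * (z.im ^ A' p + z.im ^ (-A' p))) :=
              mul_le_mul (norm_cuspWeight_le χ B _) (hb p s hsa hsb hsT z) (norm_nonneg _)
                zero_le_one
          _ = C p * (z.im ^ A' p + z.im ^ (-A' p)) := one_mul _
    _ ≤ ∑ p : Fin M × Fin M, C p * (2 * (z.im ^ At + z.im ^ (-At))) :=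
        Finset.sum_le_sum fun p _ ↦ mul_le_mul_of_nonneg_left (htwo p) (hC0 p)
    _ = 2 * (∑ p : Fin M × Fin M, C p) * (z.im ^ At + z.im ^ (-At)) := by
        rw [← Finset.sum_mul]; ring

end Transfer

end Literature.NumberTheory.EllipticCurves.ModularForms
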